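import Summits.CriticalPhenomena.PercolationContinuityZ3.Theorems.PercNearOneGluingNoHeavyLowerTailAPLProfileEdgeStep
import HarnessLib

/-!
# `NoHeavyLowerTail` (stmt-CriticalPhenomena-4575) — the sharp four-point TREE inequality (T3′), one-edge step:
# endpoint identification for the four-point events and the cross-cluster row

Support file (prover prim-ineq-gen-8 gen 40; `--supports stmt-CriticalPhenomena-4575`; memo
run/shared/lean/prim/prim-ineq-gen-8/FINDING-gen40-T3.md §1–§2).  No definitions, no named facts, no sorries.

SETTING.  `μ = prodBernoulli w` on the pairs of a finite vertex type `V`; a finite GLUED APEX SET `S`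
(`S ~ x :⟺ ∃ s ∈ S, s ↔ x`, the event `⋃ s ∈ S, openConn s x`; for `S = {a}` this is `a ↔ x`) and three further vertices.
The four-point events of the glued instance are built from
  `I_S(x) = {S ~ x}`,  `G_S(y,z) = {y ↔ z} ∪ (I_S(y) ∩ I_S(z))` (connection in the graph with `S` glued to a point),
  `M_S(x|y,z) = I_S(x) ∩ I_S(y)ᶜ ∩ {y ↔ z}` (the "two different clusters" event of the matching `x | yz`).
Fix a pair `e = s(s,t)` with `s ∈ S`, `t ∉ S`.  This file provides, in the pattern of `…APLProfileEdgeStep.lean` (gen 37):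
* `mem_reach_insert_iff_diff`, `mem_glued_insert_iff_diff`, `mem_split_insert_iff_diff` — the events of `S ∪ {t}` do not depend on
  the coordinate `e`;
* `pin_one_reach`, `pin_one_reach3`, `pin_one_glued`, `pin_one_split` — ENDPOINT IDENTIFICATION `μ_{w[e↦1]}(X_S) = μ_{w[e↦0]}(X_{S∪{t}})`;
* `reach_diff_subset`, `glued_diff_subset` — the increments: `I_{S∪t}(x) ∖ I_S(x) ⊆ {t↔x} ∩ {S ≁ t}` and
  `G_{S∪t}(y,z) ∖ G_S(y,z) ⊆ (I_S(y) ∩ {t↔z} ∩ {S≁t}) ∪ (I_S(z) ∩ {t↔y} ∩ {S≁t})`;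
* **`cross_row`** — the only probabilistic input: `μ(I_S(x) ∩ {t↔y} ∩ {S≁t}) ≤ μ(I_S(x)) · μ({t↔y} ∩ {S≁t})`
  (van den Berg–Häggström–Kahn 2006 Thm 2.1 for the sets `{t}`, `S` — `Literature.Probability.Percolation.setTwoClusterExchange` —
  followed by Harris).
The mixing lemma, the induction and the theorems are in `…APLTreeFourPointAll.lean`. [this work]
-/

noncomputable section

namespace Summit.CriticalPhenomena.PercolationContinuityZ3.Theorems

namespace APL

open MeasureTheory Set Literature.Probability.Percolation Literature.Probability.LatticeModels
  Literature.Probability.Percolation.TwoSetExchange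
open Literature.Probability.Percolation.KNPreFKG (openConn_symm)
open scoped Classical

variable {V : Type*}

/-! ### The events of `insert t S` do not depend on the edge `s–t` -/

section Events

variable (S : Set V) {s : V} (hs : s ∈ S) (t : V)
include hs

/-- `I_{S∪t}(x)` is determined by the other coordinates. [this work] -/
theorem mem_reach_insert_iff_diff (x : V) (ω : BondConfig V) :
    ω ∈ (⋃ u ∈ insert t S, (openConn u x : Set (BondConfig V))) ↔
      (ω \ {s(s, t)}) ∈ (⋃ u ∈ insert t S, (openConn u x : Set (BondConfig V))) := by
  simp only [mem_iUnion, exists_prop]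
  exact setConn_insert_iff_diff S hs t x ω

/-- `I_{S∪t}(u) ∩ I_{S∪t}(v) ∩ I_{S∪t}(w)` is determined by the other coordinates. [this work] -/
theorem mem_reach3_insert_iff_diff (u v x : V) (ω : BondConfig V) :
    ω ∈ ((⋃ y ∈ insert t S, (openConn y u : Set (BondConfig V))) ∩ (⋃ y ∈ insert t S, (openConn y v : Set (BondConfig V)))
        ∩ (⋃ y ∈ insert t S, (openConn y x : Set (BondConfig V)))) ↔
      (ω \ {s(s, t)}) ∈ ((⋃ y ∈ insert t S, (openConn y u : Set (BondConfig V)))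
        ∩ (⋃ y ∈ insert t S, (openConn y v : Set (BondConfig V))) ∩ (⋃ y ∈ insert t S, (openConn y x : Set (BondConfig V)))) := by
  simp only [mem_inter_iff]
  rw [mem_reach_insert_iff_diff S hs t u ω, mem_reach_insert_iff_diff S hs t v ω, mem_reach_insert_iff_diff S hs t x ω]

/-- `M_{S∪t}(x|y,z) = I(x) ∩ I(y)ᶜ ∩ {y↔z}` is determined by the other coordinates. [this work] -/
theorem mem_split_insert_iff_diff (x y z : V) (ω : BondConfig V) :
    ω ∈ ((⋃ u ∈ insert t S, (openConn u x : Set (BondConfig V))) ∩ (⋃ u ∈ insert t S, (openConn u y : Set (BondConfig V)))ᶜ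
        ∩ (openConn y z : Set (BondConfig V))) ↔
      (ω \ {s(s, t)}) ∈ ((⋃ u ∈ insert t S, (openConn u x : Set (BondConfig V)))
        ∩ (⋃ u ∈ insert t S, (openConn u y : Set (BondConfig V)))ᶜ ∩ (openConn y z : Set (BondConfig V))) := by
  simp only [mem_inter_iff, mem_compl_iff]
  rw [mem_reach_insert_iff_diff S hs t x ω, mem_reach_insert_iff_diff S hs t y ω]
  constructor
  · rintro ⟨⟨h1, h2⟩, h3⟩
    refine ⟨⟨h1, h2⟩, ?_⟩
    have h2' : ¬ ∃ u ∈ insert t S, (ω \ {s(s, t)}) ∈ (openConn u y : Set (BondConfig V)) := by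
      simpa only [mem_iUnion, exists_prop] using h2
    exact (conn_bc_iff_diff S hs t y z ω h2').1 h3
  · rintro ⟨⟨h1, h2⟩, h3⟩
    exact ⟨⟨h1, h2⟩, openConn_anti (fun _ hx => hx.1) h3⟩

/-- `G_{S∪t}(y,z) = {y↔z} ∪ (I(y) ∩ I(z))` is determined by the other coordinates. [this work] -/
theorem mem_glued_insert_iff_diff (y z : V) (ω : BondConfig V) :
    ω ∈ ((openConn y z : Set (BondConfig V)) ∪
        ((⋃ u ∈ insert t S, (openConn u y : Set (BondConfig V))) ∩ (⋃ u ∈ insert t S, (openConn u z : Set (BondConfig V))))) ↔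
      (ω \ {s(s, t)}) ∈ ((openConn y z : Set (BondConfig V)) ∪
        ((⋃ u ∈ insert t S, (openConn u y : Set (BondConfig V))) ∩ (⋃ u ∈ insert t S, (openConn u z : Set (BondConfig V))))) := by
  simp only [mem_union, mem_inter_iff]
  rw [mem_reach_insert_iff_diff S hs t y ω, mem_reach_insert_iff_diff S hs t z ω]
  constructor
  · rintro (h | ⟨h1, h2⟩)
    · by_cases hy : ∃ u ∈ insert t S, (ω \ {s(s, t)}) ∈ (openConn u y : Set (BondConfig V))
      · right
        refine ⟨by simpa only [mem_iUnion, exists_prop] using hy, ?_⟩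
        -- `S ∪ t` reaches `y` off `e`, hence reaches `y` in `ω`, hence `z` in `ω`, hence `z` off `e`
        have hy' : ∃ u ∈ insert t S, ω ∈ (openConn u y : Set (BondConfig V)) := (setConn_insert_iff_diff S hs t y ω).2 hy
        obtain ⟨u, hu, huy⟩ := hy'
        have hz : ∃ u ∈ insert t S, ω ∈ (openConn u z : Set (BondConfig V)) := ⟨u, hu, SimpleGraph.Reachable.trans huy h⟩
        have hz' := (setConn_insert_iff_diff S hs t z ω).1 hz
        simpa only [mem_iUnion, exists_prop] using hz'
      · left
        exact (conn_bc_iff_diff S hs t y z ω hy).1 h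
    · exact Or.inr ⟨h1, h2⟩
  · rintro (h | ⟨h1, h2⟩)
    · exact Or.inl (openConn_anti (fun _ hx => hx.1) h)
    · exact Or.inr ⟨h1, h2⟩

end Events

/-! ### Endpoint identification: `μ_{w[e↦1]}(X_S) = μ_{w[e↦0]}(X_{S ∪ {t}})` -/

section Endpoint

variable [Fintype V] (w : Sym2 V → unitInterval) (S : Finset V) {s t : V} (hs : s ∈ S) (ht : t ∉ S)
include hs ht

omit [Fintype V] hs ht in
/-- Two events that agree on `{e open}` have the same probability under `w[e↦1]`. [folklore] -/
theorem pin_one_real_congr (e : Sym2 V) {E E' : Set (BondConfig V)} (h : ∀ ω : BondConfig V, e ∈ ω → (ω ∈ E ↔ ω ∈ E')) :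
    (prodBernoulli (pinW w ({e} : Set (Sym2 V)) {e})).real E = (prodBernoulli (pinW w ({e} : Set (Sym2 V)) {e})).real E' := by
  refine measureReal_congr ?_
  filter_upwards [ae_mem_pin_one w e] with ω hω
  exact propext (h ω hω)

/-- Endpoint identification for `I(x) = {S ~ x}`. [this work] -/
theorem pin_one_reach (x : V) :
    (prodBernoulli (pinW w ({s(s, t)} : Set (Sym2 V)) {s(s, t)})).real (⋃ u ∈ (↑S : Set V), (openConn u x : Set (BondConfig V))) =
      (prodBernoulli (pinW w ({s(s, t)} : Set (Sym2 V)) (∅ : Set (Sym2 V)))).real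
        (⋃ u ∈ insert t (↑S : Set V), (openConn u x : Set (BondConfig V))) := by
  rw [← pin_one_eq_pin_zero_of_determinedBy w s(s, t)
    (determinedBy_compl_singleton_of (mem_reach_insert_iff_diff (↑S : Set V) (Finset.mem_coe.2 hs) t x))]
  refine pin_one_real_congr w s(s, t) fun ω hω => ?_
  simp only [mem_iUnion, exists_prop]
  exact setConn_iff_insert_of_mem S hs ht hω x

/-- Endpoint identification for `I(u) ∩ I(v) ∩ I(w)`. [this work] -/
theorem pin_one_reach3 (u v x : V) :
    (prodBernoulli (pinW w ({s(s, t)} : Set (Sym2 V)) {s(s, t)})).real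
        ((⋃ y ∈ (↑S : Set V), (openConn y u : Set (BondConfig V))) ∩ (⋃ y ∈ (↑S : Set V), (openConn y v : Set (BondConfig V)))
          ∩ (⋃ y ∈ (↑S : Set V), (openConn y x : Set (BondConfig V)))) =
      (prodBernoulli (pinW w ({s(s, t)} : Set (Sym2 V)) (∅ : Set (Sym2 V)))).real
        ((⋃ y ∈ insert t (↑S : Set V), (openConn y u : Set (BondConfig V)))
          ∩ (⋃ y ∈ insert t (↑S : Set V), (openConn y v : Set (BondConfig V)))
          ∩ (⋃ y ∈ insert t (↑S : Set V), (openConn y x : Set (BondConfig V)))) := by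
  rw [← pin_one_eq_pin_zero_of_determinedBy w s(s, t)
    (determinedBy_compl_singleton_of (mem_reach3_insert_iff_diff (↑S : Set V) (Finset.mem_coe.2 hs) t u v x))]
  refine pin_one_real_congr w s(s, t) fun ω hω => ?_
  simp only [mem_inter_iff, mem_iUnion, exists_prop]
  rw [setConn_iff_insert_of_mem S hs ht hω u, setConn_iff_insert_of_mem S hs ht hω v, setConn_iff_insert_of_mem S hs ht hω x]

/-- Endpoint identification for `M(x|y,z) = I(x) ∩ I(y)ᶜ ∩ {y↔z}`. [this work] -/
theorem pin_one_split (x y z : V) :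
    (prodBernoulli (pinW w ({s(s, t)} : Set (Sym2 V)) {s(s, t)})).real
        ((⋃ u ∈ (↑S : Set V), (openConn u x : Set (BondConfig V))) ∩ (⋃ u ∈ (↑S : Set V), (openConn u y : Set (BondConfig V)))ᶜ
          ∩ (openConn y z : Set (BondConfig V))) =
      (prodBernoulli (pinW w ({s(s, t)} : Set (Sym2 V)) (∅ : Set (Sym2 V)))).real
        ((⋃ u ∈ insert t (↑S : Set V), (openConn u x : Set (BondConfig V)))
          ∩ (⋃ u ∈ insert t (↑S : Set V), (openConn u y : Set (BondConfig V)))ᶜ ∩ (openConn y z : Set (BondConfig V))) := by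
  rw [← pin_one_eq_pin_zero_of_determinedBy w s(s, t)
    (determinedBy_compl_singleton_of (mem_split_insert_iff_diff (↑S : Set V) (Finset.mem_coe.2 hs) t x y z))]
  refine pin_one_real_congr w s(s, t) fun ω hω => ?_
  simp only [mem_inter_iff, mem_compl_iff, mem_iUnion, exists_prop]
  rw [setConn_iff_insert_of_mem S hs ht hω x, setConn_iff_insert_of_mem S hs ht hω y]

/-- Endpoint identification for `G(y,z) = {y↔z} ∪ (I(y) ∩ I(z))`. [this work] -/
theorem pin_one_glued (y z : V) :
    (prodBernoulli (pinW w ({s(s, t)} : Set (Sym2 V)) {s(s, t)})).real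
        ((openConn y z : Set (BondConfig V)) ∪
          ((⋃ u ∈ (↑S : Set V), (openConn u y : Set (BondConfig V))) ∩ (⋃ u ∈ (↑S : Set V), (openConn u z : Set (BondConfig V))))) =
      (prodBernoulli (pinW w ({s(s, t)} : Set (Sym2 V)) (∅ : Set (Sym2 V)))).real
        ((openConn y z : Set (BondConfig V)) ∪
          ((⋃ u ∈ insert t (↑S : Set V), (openConn u y : Set (BondConfig V)))
            ∩ (⋃ u ∈ insert t (↑S : Set V), (openConn u z : Set (BondConfig V))))) := by
  rw [← pin_one_eq_pin_zero_of_determinedBy w s(s, t)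
    (determinedBy_compl_singleton_of (mem_glued_insert_iff_diff (↑S : Set V) (Finset.mem_coe.2 hs) t y z))]
  refine pin_one_real_congr w s(s, t) fun ω hω => ?_
  simp only [mem_union, mem_inter_iff, mem_iUnion, exists_prop]
  rw [setConn_iff_insert_of_mem S hs ht hω y, setConn_iff_insert_of_mem S hs ht hω z]

end Endpoint

/-! ### The increments of `I` and `G` when `t` joins the apex set -/

section Increments

variable (S : Set V) (t : V)

/-- `I_{S∪t}(x) ∖ I_S(x) ⊆ {t ↔ x} ∩ {S ≁ t}`. [this work] -/
theorem reach_diff_subset (x : V) :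
    (⋃ u ∈ insert t S, (openConn u x : Set (BondConfig V))) \ (⋃ u ∈ S, (openConn u x : Set (BondConfig V))) ⊆
      (openConn t x : Set (BondConfig V)) ∩ (⋃ u ∈ S, (openConn u t : Set (BondConfig V)))ᶜ := by
  intro ω hω
  simp only [mem_sdiff, mem_iUnion, exists_prop, mem_insert_iff, not_exists, not_and] at hω
  obtain ⟨⟨u, hu, hux⟩, hno⟩ := hω
  rcases hu with rfl | hu
  · refine ⟨hux, ?_⟩
    simp only [mem_compl_iff, mem_iUnion, exists_prop, not_exists, not_and]
    intro u' hu' hu't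
    exact hno u' hu' (SimpleGraph.Reachable.trans hu't hux)
  · exact absurd hux (hno u hu)

/-- `G_{S∪t}(y,z) ∖ G_S(y,z) ⊆ (I_S(y) ∩ {t↔z} ∩ {S≁t}) ∪ (I_S(z) ∩ {t↔y} ∩ {S≁t})`. [this work] -/
theorem glued_diff_subset (y z : V) :
    ((openConn y z : Set (BondConfig V)) ∪
        ((⋃ u ∈ insert t S, (openConn u y : Set (BondConfig V))) ∩ (⋃ u ∈ insert t S, (openConn u z : Set (BondConfig V))))) \
      ((openConn y z : Set (BondConfig V)) ∪
        ((⋃ u ∈ S, (openConn u y : Set (BondConfig V))) ∩ (⋃ u ∈ S, (openConn u z : Set (BondConfig V))))) ⊆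
    ((⋃ u ∈ S, (openConn u y : Set (BondConfig V))) ∩ (openConn t z : Set (BondConfig V))
        ∩ (⋃ u ∈ S, (openConn u t : Set (BondConfig V)))ᶜ) ∪
      ((⋃ u ∈ S, (openConn u z : Set (BondConfig V))) ∩ (openConn t y : Set (BondConfig V))
        ∩ (⋃ u ∈ S, (openConn u t : Set (BondConfig V)))ᶜ) := by
  intro ω hω
  simp only [mem_sdiff, mem_union, mem_inter_iff, mem_iUnion, exists_prop, mem_insert_iff, not_or, not_and,
    not_exists] at hω
  obtain ⟨hG1, hyz, hnotboth⟩ := hω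
  rcases hG1 with h | ⟨⟨uy, huy, hy⟩, ⟨uz, huz, hz⟩⟩
  · exact absurd h hyz
  simp only [mem_union, mem_inter_iff, mem_compl_iff, mem_iUnion, exists_prop, not_exists, not_and]
  by_cases hSy : ∃ u ∈ S, ω ∈ (openConn u y : Set (BondConfig V))
  · -- then `S ≁ z`, so `uz = t`
    obtain ⟨u, hu, huy'⟩ := hSy
    have hSz : ∀ u' ∈ S, ω ∉ (openConn u' z : Set (BondConfig V)) := fun u' hu' h => hnotboth ⟨u, hu, huy'⟩ u' hu' h
    rcases huz with rfl | huz
    · left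
      refine ⟨⟨⟨u, hu, huy'⟩, hz⟩, fun u' hu' hu't => hSz u' hu' (SimpleGraph.Reachable.trans hu't hz)⟩
    · exact absurd hz (hSz uz huz)
  · push Not at hSy
    rcases huy with rfl | huy
    · right
      rcases huz with rfl | huz
      · exact absurd (SimpleGraph.Reachable.trans (SimpleGraph.Reachable.symm hy) hz) hyz
      · exact ⟨⟨⟨uz, huz, hz⟩, hy⟩, fun u' hu' hu't => hSy u' hu' (SimpleGraph.Reachable.trans hu't hy)⟩
    · exact absurd hy (hSy uy huy)

end Increments

/-! ### The cross-cluster row (van den Berg–Häggström–Kahn + Harris) -/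

section Cross

variable [Fintype V] (w : Sym2 V → unitInterval) (S : Set V) (t : V)

omit [Fintype V] in
/-- The BHK separation event of the sets `{t}` and `S` is `{S ≁ t}`. [folklore] -/
theorem bhkQ_single_eq :
    {ω : BondConfig V | ∀ s' ∈ ({t} : Set V), ∀ t' ∈ S, ¬ (openGraph ω).Reachable s' t'} =
      (⋃ u ∈ S, (openConn u t : Set (BondConfig V)))ᶜ := by
  ext ω
  simp only [mem_setOf_eq, mem_singleton_iff, forall_eq, mem_compl_iff, mem_iUnion, exists_prop, not_exists, not_and]
  constructor
  · intro h u hu hut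
    exact h u hu (SimpleGraph.Reachable.symm hut)
  · intro h u hu htu
    exact h u hu (SimpleGraph.Reachable.symm htu)

/-- **CROSS ROW.**  `μ(I_S(x) ∩ {t↔y} ∩ {S≁t}) ≤ μ(I_S(x)) · μ({t↔y} ∩ {S≁t})`: given that the cluster of `t` avoids `S`
and contains `y`, the glued set `S` is less likely to reach `x`.  BHK 2006 Thm 2.1 (sets `{t}`, `S`; `f = 1[t↔y]` of type (+),
`g = 1[S~x]` of type (−)) gives `μ(Q)μ(Q ∩ {t↔y} ∩ {S~x}) ≤ μ(Q ∩ {t↔y})μ(Q ∩ {S~x})` with `Q = {S≁t}`, and Harris gives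
`μ(Q ∩ {S~x}) ≤ μ(Q)μ(S~x)`. [cite: VandenbergHaggstromKahn2005, Thm. 2.1 (p. 9) — instance, derived here] -/
theorem cross_row (x y : V) :
    (prodBernoulli w).real ((⋃ u ∈ S, (openConn u x : Set (BondConfig V))) ∩ (openConn t y : Set (BondConfig V))
        ∩ (⋃ u ∈ S, (openConn u t : Set (BondConfig V)))ᶜ) ≤
      (prodBernoulli w).real (⋃ u ∈ S, (openConn u x : Set (BondConfig V))) *
        (prodBernoulli w).real ((openConn t y : Set (BondConfig V)) ∩ (⋃ u ∈ S, (openConn u t : Set (BondConfig V)))ᶜ) := by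
  have htt : t ∈ ({t} : Set V) := mem_singleton t
  have key := setTwoClusterExchange w ({t} : Set V) S
    (A₁ := (univ : Set (BondConfig V))) (A₂ := (openConn t y : Set (BondConfig V)))
    (B₁ := (univ : Set (BondConfig V))) (B₂ := ⋃ u ∈ S, (openConn u x : Set (BondConfig V)))
    (fun _ _ _ _ _ => mem_univ _)
    (fun _ _ hs' ht' h => typePlus_openConn_of_mem ({t} : Set V) S htt y hs' ht' h)
    (fun _ _ _ _ _ => mem_univ _)
    (fun _ _ hs' ht' h => typeMinus_biUnion_openConn ({t} : Set V) S x hs' ht' h)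
  rw [bhkQ_single_eq] at key
  simp only [univ_inter, inter_univ] at key
  -- names
  set Q := (⋃ u ∈ S, (openConn u t : Set (BondConfig V)))ᶜ with hQ
  set Ix := (⋃ u ∈ S, (openConn u x : Set (BondConfig V))) with hIx
  set Ty := (openConn t y : Set (BondConfig V)) with hTy
  -- Harris: `μ(Q ∩ Ix) ≤ μ(Q) μ(Ix)`
  have hup : IsUpperSet Ix := by
    rw [hIx]
    intro ω ω' hle hω
    simp only [mem_iUnion, exists_prop] at hω ⊢
    obtain ⟨u, hu, hux⟩ := hω
    exact ⟨u, hu, isUpperSet_openConn u x hle hux⟩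
  have hlow : IsLowerSet Q := by
    rw [hQ]
    refine IsUpperSet.compl ?_
    intro ω ω' hle hω
    simp only [mem_iUnion, exists_prop] at hω ⊢
    obtain ⟨u, hu, hux⟩ := hω
    exact ⟨u, hu, isUpperSet_openConn u t hle hux⟩
  have hH := prodBernoulli_harris_upper_lower w hup hlow MeasurableSet.of_discrete MeasurableSet.of_discrete
  have e1 : Ix ∩ Ty ∩ Q = Q ∩ (Ty ∩ Ix) := by ext ω; simp only [mem_inter_iff]; tauto
  have e2 : Ty ∩ Q = Q ∩ Ty := inter_comm _ _
  have e3 : Ix ∩ Q = Q ∩ Ix := inter_comm _ _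
  rw [e1, e2]
  rw [e3] at hH
  have hQ0 : 0 ≤ (prodBernoulli w).real Q := measureReal_nonneg
  have hT0 : 0 ≤ (prodBernoulli w).real (Q ∩ Ty) := measureReal_nonneg
  rcases hQ0.lt_or_eq with hQpos | hQzero
  · -- divide by μ(Q)
    have h1 : (prodBernoulli w).real Q * (prodBernoulli w).real (Q ∩ (Ty ∩ Ix)) ≤
        (prodBernoulli w).real Q * ((prodBernoulli w).real Ix * (prodBernoulli w).real (Q ∩ Ty)) := by
      calc (prodBernoulli w).real Q * (prodBernoulli w).real (Q ∩ (Ty ∩ Ix))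
          ≤ (prodBernoulli w).real (Q ∩ Ty) * (prodBernoulli w).real (Q ∩ Ix) := key
        _ ≤ (prodBernoulli w).real (Q ∩ Ty) * ((prodBernoulli w).real Ix * (prodBernoulli w).real Q) :=
            mul_le_mul_of_nonneg_left hH hT0
        _ = (prodBernoulli w).real Q * ((prodBernoulli w).real Ix * (prodBernoulli w).real (Q ∩ Ty)) := by ring
    exact le_of_mul_le_mul_left h1 hQpos
  · -- `μ(Q) = 0`
    have hle : (prodBernoulli w).real (Q ∩ (Ty ∩ Ix)) ≤ (prodBernoulli w).real Q := measureReal_mono inter_subset_left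
    rw [← hQzero] at hle
    exact hle.trans (mul_nonneg measureReal_nonneg measureReal_nonneg)

end Cross

end APL

end Summit.CriticalPhenomena.PercolationContinuityZ3.Theorems

end
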